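import Summits.QuantumFields.YangMills.Theorems.ConvexGribovBodyCovarianceBoundDefsB
import Summits.QuantumFields.YangMills.Theorems.ConvexGribovBodyCovarianceBoundStubSupMeasurable

/-!
# Stub `stub_projComponents` for the crux `CovarianceBound` (stmt-QuantumFields-8780), line `Sketch`

Route `QuantumFields/YangMills/ConvexGribovBody`, crux
`Summit.QuantumFields.YangMills.Theses.ConvexGribovBody.CovarianceBound`, skeleton line `Sketch`
(support slope × response window, `𝔤 / 𝔤^⊥` split, v5). This file proves the registered classical
stub `stub_projComponents` over the line's vocabulary (`…CovarianceBoundDefs.lean`,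
`…CovarianceBoundDefsB.lean`): the component bookkeeping for the `𝔤`-part `P_𝔤 Ĉ_j(p)`
(`lieCosMode`) and the `𝔤^⊥`-part `Ĉ_j(p) − P_𝔤 Ĉ_j(p)` (`perpCosMode`) of the mid-link cosine mode
in a measurable Coulomb-minimiser selection `sel` attaining the sup over the minimisers:

1. `∫ sup_h ‖P Ĉ‖²_F = Σ_{a,b} Σ_{q ∈ {Re, Im}} ∫ (q (P Ĉ)_{ab})²` (`‖M‖²_F = Σ_{ab} (Re² + Im²)`,
   finite sums out of the integral; integrability from measurability and the bound
   `‖P Ĉ‖²_F ≤ ‖Ĉ‖²_F ≤ N (2S+1)⁶` at the minimiser `sel U` on Wilson's probability measure);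
2. each real component `U ↦ q (P Ĉ_j(p; U, sel U))_{ab}` is measurable (joint continuity of
   `(U, h) ↦ P Ĉ_j(p; U, h)` — `P_𝔤` is a linear map of a finite-dimensional real space — composed
   with the measurable graph map `U ↦ (U, sel U)`; Borel = product σ-algebra since `G` is second
   countable through the closed embedding `ρ`);
3. the domination `(q (P Ĉ)_{ab})² ≤ ‖P Ĉ‖²_F` (one nonnegative term of a double sum).

Helper lemmas live in the sub-namespace `ProjComponents`. No named facts are used.
-/

set_option autoImplicit false

noncomputable section

namespace Summit.QuantumFields.YangMills.Cruxes.CovarianceBound.SupportWindow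

open scoped BigOperators Topology Matrix ComplexConjugate
open Filter Set Function TopologicalSpace MeasureTheory
open Literature.MathematicalPhysics.QuantumFieldTheory

/-! ### Helper lemmas (sub-namespace `ProjComponents`) -/

namespace ProjComponents

/-! #### Real components of a matrix and of a bounded matrix-valued observable -/

/-- `(Re M_{ab})², (Im M_{ab})² ≤ ‖M‖²_F`. [folklore] -/
theorem comp_sq_le_froSq {N : ℕ} (M : Matrix (Fin N) (Fin N) ℂ) (a b : Fin N) (q : Bool) :
    (bif q then (M a b).re else (M a b).im) ^ 2 ≤ froSq M := by
  have h1 : (bif q then (M a b).re else (M a b).im) ^ 2 ≤ ‖M a b‖ ^ 2 := by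
    rw [Complex.sq_norm, Complex.normSq_apply]
    cases q <;> simp only [cond_true, cond_false] <;>
      nlinarith [mul_self_nonneg (M a b).re, mul_self_nonneg (M a b).im]
  exact h1.trans ((Finset.single_le_sum (f := fun b' => ‖M a b'‖ ^ 2)
      (fun _ _ => by positivity) (Finset.mem_univ b)).trans
    (Finset.single_le_sum (f := fun a' => ∑ b', ‖M a' b'‖ ^ 2)
      (fun _ _ => Finset.sum_nonneg fun _ _ => by positivity) (Finset.mem_univ a)))

/-- `‖M‖²_F = Σ_{ab} ((Re M_{ab})² + (Im M_{ab})²)`, the inner sum indexed by `Bool`. [folklore] -/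
theorem froSq_eq_sum_comp_sq {N : ℕ} (M : Matrix (Fin N) (Fin N) ℂ) :
    froSq M = ∑ a, ∑ b, ∑ q : Bool, (bif q then (M a b).re else (M a b).im) ^ 2 := by
  unfold froSq
  refine Finset.sum_congr rfl fun a _ => Finset.sum_congr rfl fun b _ => ?_
  rw [Fintype.sum_bool, Complex.sq_norm, Complex.normSq_apply]
  simp only [cond_true, cond_false]
  ring

/-- **Component bookkeeping.** For a matrix-valued observable `F` with measurable entries and
`‖F‖²_F ≤ B` on a finite measure space: `∫ ‖F‖²_F = Σ_{ab} Σ_q ∫ (q F_{ab})²` (`q ∈ {Re, Im}`), each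
real component is measurable, and `(q F_{ab})² ≤ ‖F‖²_F` pointwise. [folklore] -/
theorem integral_froSq_eq_sum {Ω : Type*} [MeasurableSpace Ω] (μ : Measure Ω) [IsFiniteMeasure μ]
    {N : ℕ} {F : Ω → Matrix (Fin N) (Fin N) ℂ} (hF : ∀ a b, Measurable fun ω => F ω a b) {B : ℝ}
    (hB : ∀ ω, froSq (F ω) ≤ B) :
    (∫ ω, froSq (F ω) ∂μ =
        ∑ a, ∑ b, ∑ q : Bool, ∫ ω, (bif q then (F ω a b).re else (F ω a b).im) ^ 2 ∂μ) ∧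
      (∀ (a b : Fin N) (q : Bool),
        Measurable fun ω => bif q then (F ω a b).re else (F ω a b).im) ∧
      ∀ (a b : Fin N) (q : Bool) (ω : Ω),
        (bif q then (F ω a b).re else (F ω a b).im) ^ 2 ≤ froSq (F ω) := by
  have hm : ∀ (a b : Fin N) (q : Bool),
      Measurable fun ω => bif q then (F ω a b).re else (F ω a b).im := by
    intro a b q
    cases q
    · exact Complex.measurable_im.comp (hF a b)
    · exact Complex.measurable_re.comp (hF a b)
  have hdom : ∀ (a b : Fin N) (q : Bool) (ω : Ω),
      (bif q then (F ω a b).re else (F ω a b).im) ^ 2 ≤ froSq (F ω) := fun a b q ω =>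
    comp_sq_le_froSq (F ω) a b q
  have hint : ∀ (a b : Fin N) (q : Bool),
      Integrable (fun ω => (bif q then (F ω a b).re else (F ω a b).im) ^ 2) μ := fun a b q =>
    Integrable.of_mem_Icc 0 B ((hm a b q).pow_const 2).aemeasurable
      (ae_of_all _ fun ω => ⟨sq_nonneg _, (hdom a b q ω).trans (hB ω)⟩)
  refine ⟨?_, hm, hdom⟩
  simp_rw [froSq_eq_sum_comp_sq]
  rw [integral_finsetSum _ fun a _ =>
    integrable_finsetSum _ fun b _ => integrable_finsetSum _ fun q _ => hint a b q]
  refine Finset.sum_congr rfl fun a _ => ?_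
  rw [integral_finsetSum _ fun b _ => integrable_finsetSum _ fun q _ => hint a b q]
  exact Finset.sum_congr rfl fun b _ => integral_finsetSum _ fun q _ => hint a b q

/-! #### The projected modes: contraction, joint continuity, measurability in a measurable gauge -/

variable {G : Type} [Group G] [TopologicalSpace G]

/-- Pythagoras for the `Re tr(X Yᴴ)`-orthogonal projection onto `𝔤`:
`‖X‖²_F = ‖P_𝔤 X‖²_F + ‖X − P_𝔤 X‖²_F`. [folklore] -/
private theorem froSq_eq_lieProj_add' (r : LatticeRep G) (X : Matrix (Fin r.N) (Fin r.N) ℂ) :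
    froSq X = froSq (r.lieProj X) + froSq (X - r.lieProj X) := by
  have hfs : ∀ Y : Matrix (Fin r.N) (Fin r.N) ℂ, froSq Y = hsForm r.N Y Y := fun Y => by
    rw [hsForm_self]; rfl
  have h0 : hsForm r.N (r.lieProj X) (X - r.lieProj X) = 0 :=
    r.hsForm_sub_lieProj (r.lieProj_mem X)
  have h0' : hsForm r.N (X - r.lieProj X) (r.lieProj X) = 0 := by rw [hsForm_comm]; exact h0
  simp only [hfs]
  conv_lhs => rw [show X = r.lieProj X + (X - r.lieProj X) by abel]
  simp only [map_add, LinearMap.add_apply, h0, h0']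
  ring

/-- `P_𝔤` and `1 − P_𝔤` are contractions for `‖·‖_F`:
`‖P_𝔤 X‖²_F ≤ ‖X‖²_F` and `‖X − P_𝔤 X‖²_F ≤ ‖X‖²_F`. [folklore] -/
theorem froSq_lieProj_le_and (r : LatticeRep G) (X : Matrix (Fin r.N) (Fin r.N) ℂ) :
    froSq (r.lieProj X) ≤ froSq X ∧ froSq (X - r.lieProj X) ≤ froSq X := by
  rw [froSq_eq_lieProj_add' r X]
  exact ⟨le_add_of_nonneg_right (SupMeasurable.froSq_nonneg _),
    le_add_of_nonneg_left (SupMeasurable.froSq_nonneg _)⟩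

/-- The mid-link cosine mode is jointly continuous in `(U, h)` (matrix-valued). [folklore] -/
private theorem continuous_cosMode' [IsTopologicalGroup G] (r : LatticeRep G) (S : ℕ)
    (p : Fin 3 → ZMod (2 * S + 1)) (j : Fin 3) :
    Continuous fun q : GaugeConfig 4 (2 * S + 1) G × (Site 4 (2 * S + 1) → G) =>
      cosMode r S p j q.1 q.2 := by
  unfold cosMode
  exact continuous_finsetSum _ fun y _ => (SupMeasurable.continuous_gluon r S y j).fun_const_smul _

/-- `(U, h) ↦ P_𝔤 Ĉ_j(p; U, h)` is jointly continuous (`P_𝔤` is a linear endomorphism of the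
finite-dimensional real space `M_N(ℂ)`). [folklore] -/
theorem continuous_lieCosMode [IsTopologicalGroup G] (r : LatticeRep G) (S : ℕ)
    (p : Fin 3 → ZMod (2 * S + 1)) (j : Fin 3) :
    Continuous fun q : GaugeConfig 4 (2 * S + 1) G × (Site 4 (2 * S + 1) → G) =>
      lieCosMode r S p j q.1 q.2 :=
  (LinearMap.continuous_of_finiteDimensional _).comp (continuous_cosMode' r S p j)

/-- `(U, h) ↦ Ĉ_j(p; U, h) − P_𝔤 Ĉ_j(p; U, h)` is jointly continuous. [folklore] -/
theorem continuous_perpCosMode [IsTopologicalGroup G] (r : LatticeRep G) (S : ℕ)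
    (p : Fin 3 → ZMod (2 * S + 1)) (j : Fin 3) :
    Continuous fun q : GaugeConfig 4 (2 * S + 1) G × (Site 4 (2 * S + 1) → G) =>
      perpCosMode r S p j q.1 q.2 :=
  (continuous_cosMode' r S p j).sub (continuous_lieCosMode r S p j)

/-- In a measurable gauge `sel`, the entries of a jointly continuous matrix-valued `M(U, h)` are
measurable functions of `U` (Borel = product σ-algebra: `G` is second countable through the closed
embedding `ρ`). [folklore] -/
theorem measurable_apply_sel [IsTopologicalGroup G] [CompactSpace G] [MeasurableSpace G]
    [BorelSpace G] (r : LatticeRep G) (S : ℕ) {N : ℕ}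
    {M : GaugeConfig 4 (2 * S + 1) G → (Site 4 (2 * S + 1) → G) → Matrix (Fin N) (Fin N) ℂ}
    (hM : Continuous fun q : GaugeConfig 4 (2 * S + 1) G × (Site 4 (2 * S + 1) → G) => M q.1 q.2)
    {sel : GaugeConfig 4 (2 * S + 1) G → (Site 4 (2 * S + 1) → G)} (hsel : Measurable sel)
    (a b : Fin N) : Measurable fun U => M U (sel U) a b := by
  haveI : SecondCountableTopology G :=
    (r.continuous.isClosedEmbedding r.injective).isEmbedding.secondCountableTopology
  exact (hM.matrix_elem a b).measurable.comp (measurable_id.prodMk hsel)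

end ProjComponents

/-! ### The stub -/

open ProjComponents in
/-- **Stub `stub_projComponents` (classical).** Component bookkeeping for the `𝔤`-part `P_𝔤 Ĉ_j(p)`
and the `𝔤^⊥`-part `Ĉ_j(p) − P_𝔤 Ĉ_j(p)` of the mid-link cosine mode in a measurable Coulomb-minimiser
selection `sel` attaining the sup over the minimisers: the integral of the sup is the sum of the
`2N²` component second moments (integrability on Wilson's probability measure from measurability and
`‖P Ĉ‖²_F ≤ ‖Ĉ‖²_F ≤ N(2S+1)⁶` at the minimiser), every real component is measurable (joint
continuity of `(U, h) ↦ P Ĉ_j(p; U, h)` composed with the measurable graph of `sel`; `G` is second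
countable through `ρ`), and `(Re/Im (P Ĉ)_{ab})² ≤ ‖P Ĉ‖²_F`. [folklore] -/
theorem stub_projComponents :
    ∀ (G : Type) [Group G] [TopologicalSpace G] [IsTopologicalGroup G] [CompactSpace G]
      [MeasurableSpace G] [BorelSpace G] (r : LatticeRep G) (β : ℝ) (S : ℕ)
      (p : Fin 3 → ZMod (2 * S + 1)) (j : Fin 3)
      (sel : GaugeConfig 4 (2 * S + 1) G → (Site 4 (2 * S + 1) → G)),
      Measurable sel → (∀ U, IsCoulMin r S U (sel U)) →
      (∀ (U : GaugeConfig 4 (2 * S + 1) G) (h : Site 4 (2 * S + 1) → G), IsCoulMin r S U h →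
        froSq (cosMode r S p j U h) ≤ r.N * (2 * S + 1 : ℝ) ^ 6) →
      ((∀ U, froSq (lieCosMode r S p j U (sel U)) = supLieCosSq r S p j U) →
        Measurable (supLieCosSq r S p j) →
        (∫ U, supLieCosSq r S p j U ∂(wilson4 r β S) =
          ∑ a : Fin r.N, ∑ b : Fin r.N, ∑ q : Bool,
            ∫ U, (lieCosComp r S p j a b q sel U) ^ 2 ∂(wilson4 r β S)) ∧
        (∀ (a b : Fin r.N) (q : Bool), Measurable (lieCosComp r S p j a b q sel)) ∧
        (∀ (a b : Fin r.N) (q : Bool) (U : GaugeConfig 4 (2 * S + 1) G),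
          (lieCosComp r S p j a b q sel U) ^ 2 ≤ froSq (lieCosMode r S p j U (sel U)))) ∧
      ((∀ U, froSq (perpCosMode r S p j U (sel U)) = supPerpCosSq r S p j U) →
        Measurable (supPerpCosSq r S p j) →
        (∫ U, supPerpCosSq r S p j U ∂(wilson4 r β S) =
          ∑ a : Fin r.N, ∑ b : Fin r.N, ∑ q : Bool,
            ∫ U, (perpCosComp r S p j a b q sel U) ^ 2 ∂(wilson4 r β S)) ∧
        (∀ (a b : Fin r.N) (q : Bool), Measurable (perpCosComp r S p j a b q sel)) ∧
        (∀ (a b : Fin r.N) (q : Bool) (U : GaugeConfig 4 (2 * S + 1) G),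
          (perpCosComp r S p j a b q sel U) ^ 2 ≤ froSq (perpCosMode r S p j U (sel U)))) := by
  intro G _ _ _ _ _ _ r β S p j sel hsel hmin hbd
  -- entrywise measurability of the two projected modes in the gauge `sel`
  have hFl : ∀ a b, Measurable fun U => lieCosMode r S p j U (sel U) a b :=
    measurable_apply_sel r S (continuous_lieCosMode r S p j) hsel
  have hFp : ∀ a b, Measurable fun U => perpCosMode r S p j U (sel U) a b :=
    measurable_apply_sel r S (continuous_perpCosMode r S p j) hsel
  -- bounds at the minimiser `sel U` (both projections are `‖·‖_F`-contractions)
  have hBl : ∀ U, froSq (lieCosMode r S p j U (sel U)) ≤ r.N * (2 * S + 1 : ℝ) ^ 6 := fun U =>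
    (froSq_lieProj_le_and r _).1.trans (hbd U (sel U) (hmin U))
  have hBp : ∀ U, froSq (perpCosMode r S p j U (sel U)) ≤ r.N * (2 * S + 1 : ℝ) ^ 6 := fun U =>
    (froSq_lieProj_le_and r _).2.trans (hbd U (sel U) (hmin U))
  obtain ⟨hIl, hml, hdl⟩ := integral_froSq_eq_sum (wilson4 r β S) hFl hBl
  obtain ⟨hIp, hmp, hdp⟩ := integral_froSq_eq_sum (wilson4 r β S) hFp hBp
  refine ⟨fun hsup _ => ⟨?_, hml, hdl⟩, fun hsup _ => ⟨?_, hmp, hdp⟩⟩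
  · simp_rw [← hsup]
    exact hIl
  · simp_rw [← hsup]
    exact hIp

end Summit.QuantumFields.YangMills.Cruxes.CovarianceBound.SupportWindow

end
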